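import Literature.NumberTheory.Automorphic.Sweep1PotentialModularityReductionProofs
import Literature.NumberTheory.EllipticCurves.HasseWeilGoodReductionProofs
import HarnessLib

/-!
# Potential modularity of elliptic curves over CM fields (lang.S28): the Galois half of
# `IsTateAutomorphic` is a theorem — `IsTateAutomorphic ↔ IsModular`, and the Galois form of
# lang.S28 is exactly the `Sweep1` fact with `F'/F` Galois

Pure-proof sibling (theorems only, D-0014 append protocol) of
`Literature.NumberTheory.Automorphic.Sweep1PotentialModularity`, written by the tenured seat of its
former named fact `Literature.NumberTheory.Automorphic.exists_isCMField_isTateAutomorphic`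
(**lang.S28, Galois form**: Allen–Calegari–Caraiani–Gee–Helm–Le Hung–Newton–Scholze–Taylor–Thorne,
*Potential automorphy over CM fields*, Ann. of Math. (2) 197 (2023), 897–1113, Cor. 7.1.12 for
`m = 1` and the compatible system `R_E` of a non-CM elliptic curve, i.e. Thm. 1.0.1 in the non-CM
case; held copy `lit:arxiv-1812.09999`, where Cor. 7.1.12 is "Corollary 141", p. 102, and the §7.1
definition of an *automorphic* very weakly compatible system is on p. 100).  The review of
2026-08-15 (D-0026: a decomposition child must not carry the whole parent) merged that named fact
back into its parent obligation `Literature.NumberTheory.Automorphic.exists_isCMField_isModular`: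
the Galois-form statement is no longer a `Prop` constant of the tree and is spelled out below
wherever it occurs (theorem names are unchanged).

## Triage of the Galois form (recorded for the ledger)

The definition `WeierstrassCurve.IsTateAutomorphic W` of the parent file is a conjunction, at all
but finitely many finite places `v`, of

* an **automorphic half** — a cuspidal `Π ≤ L²_cusp(GL₂(F) \ GL₂(𝔸_F) / A_G)` with one level
  `K(𝔫)` and a Satake parameter `{α₁, α₂}` at `v` with `∏ (X - q_v^{1/2} αᵢ) = X² - a X + q_v` for an
  integer `a` (the §7.1 condition "`rec(π_v |det|_v^{-1/2})(Frob_v)` has characteristic polynomial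
  `ı(Q_v(X))`", read in the unitary normalisation of `GLnAdelicStructure`), and
* a **Galois half** — for every prime `ℓ` with `v ∤ ℓ`, the rational Tate module `V_ℓ E` is
  unramified at `v` and every arithmetic Frobenius at `v` has characteristic polynomial
  `X² - a X + q_v` on it (condition (5a) of a very weakly compatible system for `R_E`).

The Galois half is now a **theorem of the tree** at every place `v ∤ ℓ` of good reduction, with
`a = a_v(E) = q_v + 1 - #Ẽ_v(k_v)` (`WeierstrassCurve.frobeniusTraceAt`): unramifiedness is
`WeierstrassCurve.isUnramifiedAt_rationalTateGaloisRepOf_geomPoints` (Silverman, *AEC*,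
Prop. VII.4.1(b); `GoodReductionUnramifiedProofs`) and the Frobenius characteristic polynomial is
`WeierstrassCurve.hasFrobCharpolyAt_rationalTateGaloisRepOf_of_hasGoodReductionAt`
(`HasseWeilGoodReductionFrobenius`; Silverman C.21 Remark 21.3) fed with the discharged trace and
determinant facts `trace/det_galoisRepTate_frobenius_of_hasGoodReductionAt_holds`
(`HasseWeilGoodReductionProofs`: the reduction isomorphism `T_ℓ E ≅ T_ℓ Ẽ_v`, the Weil pairing and
Thm. V.2.3.1, all proved).  Since Mathlib's local polynomial at a good place is
`L_v(E, T) = 1 - a_v T + q_v T²` with the same `a_v` (`localPolynomialAt_of_hasGoodReductionAt`),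
the automorphic half alone is `WeierstrassCurve.IsModular` of `Sweep1`.  Hence this file proves:

* `WeierstrassCurve.IsModular.isTateAutomorphic` (**proved**): a modular elliptic curve over a
  number field (`Sweep1`: `L_v(E, T) = ∏ (1 - q_v^{1/2} αᵢ T)` at almost all `v`) is
  Tate-automorphic — the converse of `WeierstrassCurve.isModular_of_isTateAutomorphic`
  (`Sweep1PotentialModularityReductionProofs`); so `WeierstrassCurve.isTateAutomorphic_iff_isModular`.
* `Literature.NumberTheory.Automorphic.exists_isCMField_isTateAutomorphic_iff` (**proved**): the
  Galois form of lang.S28 ("… such that `E ×_F F'` is Tate-automorphic") is *equivalent* to the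
  statement "for every
  elliptic curve `E` without geometric CM over a CM number field `F` there is a finite extension
  `F'/F`, **Galois**, with `F'` a CM field, such that `E ×_F F'` is modular (`IsModular`)" — that
  is, to the accepted `Sweep1` formulation `exists_isCMField_isModular` of lang.S28 strengthened
  by the single printed word "Galois" (Cor. 7.1.12: *"there exists a finite Galois CM extension
  `F'/F`"*), which `exists_isCMField_isModular` omits.  In particular the Galois form implies
  `exists_isCMField_isModular`
  (`exists_isCMField_isModular_of_exists_isCMField_isTateAutomorphic`, earlier) and carries **no**
  Galois-representation-theoretic debt beyond the automorphic statement.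

What remains owed (the obligation `exists_isCMField_isModular`, and its strong form with soluble
descent `exists_isCMField_forall_isSolvable_isTateAutomorphic` of
`Sweep1PotentialModularitySolubleDescent`) is therefore exactly the automorphic existence
statement of the source — a
cuspidal automorphic representation of `GL₂` over a finite Galois CM extension with Hecke
eigenvalues `a_v(E)` at almost all places — whose printed proof (§7.2: the automorphy lifting
Theorems 6.1.1/6.1.2 over CM fields, resting on the Galois representations attached to torsion
classes and local–global compatibility, §§2–6; potential automorphy over totally real fields,
Prop. 7.2.3/Cor. 7.2.4 after [BLGGT14]; the theorem of Moret-Bailly; soluble base change) has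
hypotheses — crystalline representations with Hodge–Tate weights labelled by embeddings,
decomposed-generic and enormous residual images — without a faithful carrier in Mathlib or
`Literature` today (`GaloisRepresentations/PAdicHodge` offers `p`-adic Hodge theory only relative
to an abstract `PeriodRingData`).  Triage: **XL**.

## References

* [AllenCalegariCaraianiGeeEtAl2023] P. B. Allen, F. Calegari, A. Caraiani, T. Gee, D. Helm,
  B. V. Le Hung, J. Newton, P. Scholze, R. Taylor, J. A. Thorne, *Potential automorphy over CM
  fields*, Ann. of Math. (2) 197 (2023), 897–1113: Thm. 1.0.1, §7.1 (p. 100 of the held copy),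
  Thm. 7.1.11, Cor. 7.1.12 (p. 102), §7.2 (pp. 103–107).
* [SilvermanAEC2009] J. H. Silverman, *The Arithmetic of Elliptic Curves*, 2nd ed., GTM 106
  (2009): Prop. VII.4.1(b), Thm. V.2.3.1, C.§16, C.21 Remark 21.3, Rem. VIII.1.3.

## Design

No definitions, no instances, no `sorry`; universe-`0` number fields (`{F : Type}`) as in
`Sweep1`.  The right-hand side of `exists_isCMField_isTateAutomorphic_iff` is spelled out rather
than named, so that no new `Prop` constant (no new debt) is introduced.  Elementary helper:
`coeff_eulerQuadratic_eq` (comparing coefficients of `1 - s X + p X²`), companion of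
`coeff_quadratic_eq` of the parent file.
-/

noncomputable section

open scoped MatrixGroups Polynomial NumberField
open NumberField IsDedekindDomain MeasureTheory Filter Polynomial

namespace Literature.NumberTheory.Automorphic

/-- Comparing coefficients of two normalised reversed quadratics
`1 - s X + p X² = 1 - s' X + p' X²`. [folklore] -/
theorem coeff_eulerQuadratic_eq {R : Type*} [CommRing R] {s p s' p' : R}
    (h : (1 : R[X]) - C s * X + C p * X ^ 2 = 1 - C s' * X + C p' * X ^ 2) : s = s' ∧ p = p' := by
  constructor
  · have := congrArg (fun f : R[X] => f.coeff 1) h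
    simpa using this
  · have := congrArg (fun f : R[X] => f.coeff 2) h
    simpa using this

/-- **A modular elliptic curve is Tate-automorphic: the Galois half of `IsTateAutomorphic` is a
theorem.**  Let `E/F` be an elliptic curve over a number field which is modular in the sense of
`WeierstrassCurve.IsModular` (`Sweep1`): a cuspidal `Π ≤ L²_cusp(GL₂)`, one level `K(𝔫)`, and at
all but finitely many `v` a Satake parameter `{α₁, α₂}` with `L_v(E, T) = ∏ (1 - q_v^{1/2} αᵢ T)`.
Then `E` is Tate-automorphic (`WeierstrassCurve.IsTateAutomorphic`, the §7.1 notion "`R_E` is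
automorphic" of Allen et al. read on the tree's objects) with the same `Π` and `𝔫`, the integer at
`v` being the trace of Frobenius `a_v = q_v + 1 - #Ẽ_v(k_v)` (`frobeniusTraceAt`).  Proof, at a
place `v` of the cofinite set which is moreover of good reduction
(`eventually_hasGoodReductionAt`, Silverman Rem. VIII.1.3): `L_v(E, T) = 1 - a_v T + q_v T²`
(`localPolynomialAt_of_hasGoodReductionAt`, C.§16), so comparing coefficients
`q_v^{1/2}(α₁ + α₂) = a_v`, `q_v α₁ α₂ = q_v` and `∏ (X - q_v^{1/2} αᵢ) = X² - a_v X + q_v`; and for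
every prime `ℓ` with `v ∤ ℓ`, `V_ℓ E` is unramified at `v` (Prop. VII.4.1(b),
`isUnramifiedAt_rationalTateGaloisRepOf_geomPoints`) with Frobenius characteristic polynomial
`X² - a_v X + q_v` (C.21 Remark 21.3, `hasFrobCharpolyAt_rationalTateGaloisRepOf_of_hasGoodReductionAt`
with the discharged trace and determinant facts).  Converse of
`WeierstrassCurve.isModular_of_isTateAutomorphic`.
[cite: SilvermanAEC2009, Prop. VII.4.1(b), C.§16 and C.21 Remark 21.3] -/
theorem _root_.WeierstrassCurve.IsModular.isTateAutomorphic {F : Type} [Field F] [NumberField F]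
    {W : WeierstrassCurve F} [W.IsElliptic] (hW : W.IsModular) : W.IsTateAutomorphic := by
  obtain ⟨μ, hμ, P, 𝔫, h𝔫, hev⟩ := hW
  refine ⟨μ, hμ, P, 𝔫, h𝔫, ?_⟩
  filter_upwards [hev, W.eventually_hasGoodReductionAt] with v hv hgood
  obtain ⟨hv𝔫, ϖ, α, hSat, hL⟩ := hv
  refine ⟨hv𝔫, ϖ, α, W.frobeniusTraceAt v, hSat, ?_, ?_⟩
  · -- the automorphic half: `L_v(E, T) = 1 - a_v T + q_v T² = (1 - √q α₁ T)(1 - √q α₂ T)`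
    obtain ⟨z₁, z₂, rfl⟩ := Multiset.card_eq_two.1 hSat.card_eq
    set c : ℂ := ((Real.sqrt (v.residueCard : ℝ) : ℝ) : ℂ) with hc_def
    have hloc := WeierstrassCurve.localPolynomialAt_of_hasGoodReductionAt hgood
    rw [WeierstrassCurve.natCard_residueField_eq_residueCard] at hloc
    change (W.localPolynomialAt v).map (Int.castRingHom ℂ) = _ at hL
    rw [hloc, Multiset.insert_eq_cons, Multiset.map_cons, Multiset.prod_cons,
      Multiset.map_singleton, Multiset.prod_singleton] at hL
    have hL' : (1 : ℂ[X]) - Polynomial.C (c * z₁ + c * z₂) * X +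
          Polynomial.C (c * z₁ * (c * z₂)) * X ^ 2 =
        1 - Polynomial.C (W.frobeniusTraceAt v : ℂ) * X +
          Polynomial.C ((v.residueCard : ℕ) : ℂ) * X ^ 2 := by
      rw [← one_sub_mul_one_sub]
      symm
      simpa [Polynomial.map_sub, Polynomial.map_add, Polynomial.map_mul, Polynomial.map_pow]
        using hL
    obtain ⟨hsum, hprod⟩ := coeff_eulerQuadratic_eq hL'
    rw [Multiset.insert_eq_cons, Multiset.map_cons, Multiset.prod_cons, Multiset.map_singleton,
      Multiset.prod_singleton, X_sub_C_mul_X_sub_C, hsum, hprod]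
    simp [frobPoly, Polynomial.map_sub, Polynomial.map_add, Polynomial.map_mul,
      Polynomial.map_pow]
  · -- the Galois half: `V_ℓ E` is unramified at `v` with `det(X - Frob_v) = X² - a_v X + q_v`
    intro ℓ _ hvℓ h hfin
    refine ⟨W.isUnramifiedAt_rationalTateGaloisRepOf_geomPoints ℓ h hgood hvℓ, ?_⟩
    have key := WeierstrassCurve.hasFrobCharpolyAt_rationalTateGaloisRepOf_of_hasGoodReductionAt
      (W.trace_galoisRepTate_frobenius_of_hasGoodReductionAt_holds ℓ)
      (W.det_galoisRepTate_frobenius_of_hasGoodReductionAt_holds ℓ) h hvℓ hgood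
    rw [WeierstrassCurve.natCard_residueField_eq_residueCard] at key
    have hpoly : (frobPoly (W.frobeniusTraceAt v) v.residueCard).map (Int.castRingHom ℚ_[ℓ]) =
        X ^ 2 - Polynomial.C (W.frobeniusTraceAt v : ℚ_[ℓ]) * X +
          Polynomial.C ((v.residueCard : ℕ) : ℚ_[ℓ]) := by
      simp [frobPoly, Polynomial.map_sub, Polynomial.map_add, Polynomial.map_mul,
        Polynomial.map_pow]
    rw [hpoly]
    exact key

/-- **Tate-automorphy is modularity**, for an elliptic curve over a number field: the conjunction
of `WeierstrassCurve.IsModular.isTateAutomorphic` (this file) and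
`WeierstrassCurve.isModular_of_isTateAutomorphic` (`Sweep1PotentialModularityReductionProofs`).
The §7.1 condition of Allen et al. for `R_E`, read on the tree's `L²` objects, is thus equivalent
to the Euler-factor condition `L_v(E, T) = ∏ (1 - q_v^{1/2} αᵢ T)` of `Sweep1` at almost all `v`.
[cite: AllenCalegariCaraianiGeeEtAl2023, §7.1 (definition of an automorphic compatible system, for R = R_E)] -/
theorem _root_.WeierstrassCurve.isTateAutomorphic_iff_isModular {F : Type} [Field F] [NumberField F]
    (W : WeierstrassCurve F) [W.IsElliptic] : W.IsTateAutomorphic ↔ W.IsModular :=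
  ⟨fun h => WeierstrassCurve.isModular_of_isTateAutomorphic h, fun h => h.isTateAutomorphic⟩

/-- **lang.S28, Galois form = `Sweep1` form with `F'/F` Galois.**  The Galois form of lang.S28
(Allen–Calegari–Caraiani–Gee–Helm–Le Hung–Newton–Scholze–Taylor–Thorne, Ann. of Math. 197 (2023),
Cor. 7.1.12 for `m = 1` and `R = R_E`; Thm. 1.0.1, non-CM case: *for every elliptic curve `E`
without geometric CM over a CM number field `F` there is a finite extension `F'/F`, Galois over
`F`, with `F'` a CM field, such that `E ×_F F'` is Tate-automorphic* — the left-hand side, formerly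
the named fact `exists_isCMField_isTateAutomorphic`) is equivalent to: *for every elliptic curve `E` without
geometric complex multiplication over a CM number field `F` there is a finite extension `F'/F`,
Galois over `F`, with `F'` a CM field, such that `E ×_F F'` is modular* (`WeierstrassCurve.IsModular`
of `Sweep1`: a cuspidal `Π` on `GL₂/F'` whose Satake parameters at one level reproduce
`L_v(E ×_F F', T)` at almost all `v`).  This is the accepted formulation
`Literature.NumberTheory.Automorphic.exists_isCMField_isModular` with the printed word *Galois*
("there exists a finite Galois CM extension `F'/F`", Cor. 7.1.12) restored; pointwise
`WeierstrassCurve.isTateAutomorphic_iff_isModular` for the elliptic curve `E ×_F F'`.  So the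
Galois form owes nothing on the Galois side: what is owed is the automorphic existence statement
of the source.
[cite: AllenCalegariCaraianiGeeEtAl2023, Cor. 7.1.12 (m = 1, R = R_E) with §7.1; Thm. 1.0.1 (non-CM case)] -/
theorem exists_isCMField_isTateAutomorphic_iff :
    (∀ {F : Type} [Field F] [NumberField F] [IsCMField F] (W : WeierstrassCurve F) [W.IsElliptic]
        (_hW : ¬ W.HasCM),
        ∃ (F' : Type) (_ : Field F') (_ : NumberField F') (_ : Algebra F F'),
          IsCMField F' ∧ IsGalois F F' ∧ (W.baseChange F').IsTateAutomorphic) ↔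
      ∀ {F : Type} [Field F] [NumberField F] [IsCMField F] (W : WeierstrassCurve F) [W.IsElliptic]
        (_hW : ¬ W.HasCM),
        ∃ (F' : Type) (_ : Field F') (_ : NumberField F') (_ : Algebra F F'),
          IsCMField F' ∧ IsGalois F F' ∧ (W.baseChange F').IsModular := by
  constructor
  · intro h F _ _ _ W _ hW
    obtain ⟨F', _, _, _, hCM, hGal, hT⟩ := h W hW
    haveI : (W.baseChange F').IsElliptic := by
      dsimp only [WeierstrassCurve.baseChange]
      infer_instance
    exact ⟨F', _, _, _, hCM, hGal, WeierstrassCurve.isModular_of_isTateAutomorphic hT⟩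
  · intro h F _ _ _ W _ hW
    obtain ⟨F', _, _, _, hCM, hGal, hM⟩ := h W hW
    haveI : (W.baseChange F').IsElliptic := by
      dsimp only [WeierstrassCurve.baseChange]
      infer_instance
    exact ⟨F', _, _, _, hCM, hGal, hM.isTateAutomorphic⟩

/-- **The `Sweep1` form with `F'/F` Galois implies the Galois form** (the useful direction of
`exists_isCMField_isTateAutomorphic_iff`, as an implication ready to be fed a proof of the
automorphic statement): if every elliptic curve without geometric CM over a CM field becomes
modular over some finite *Galois* CM extension, then the Galois form of lang.S28 holds (every such
curve becomes Tate-automorphic over a finite Galois CM extension).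
[cite: AllenCalegariCaraianiGeeEtAl2023, Cor. 7.1.12 (m = 1, R = R_E)] -/
theorem exists_isCMField_isTateAutomorphic_of_galois_isModular
    (h : ∀ {F : Type} [Field F] [NumberField F] [IsCMField F] (W : WeierstrassCurve F) [W.IsElliptic]
        (_hW : ¬ W.HasCM),
        ∃ (F' : Type) (_ : Field F') (_ : NumberField F') (_ : Algebra F F'),
          IsCMField F' ∧ IsGalois F F' ∧ (W.baseChange F').IsModular)
    {F : Type} [Field F] [NumberField F] [IsCMField F] (W : WeierstrassCurve F) [W.IsElliptic]
    (hW : ¬ W.HasCM) :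
    ∃ (F' : Type) (_ : Field F') (_ : NumberField F') (_ : Algebra F F'),
      IsCMField F' ∧ IsGalois F F' ∧ (W.baseChange F').IsTateAutomorphic :=
  exists_isCMField_isTateAutomorphic_iff.2 h W hW

end Literature.NumberTheory.Automorphic
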